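import Literature.AlgebraicGeometry.HodgeTheory.DivisorAlgebraSelfProduct
import Literature.AlgebraicGeometry.Milne1999.SpecialLefschetzGroupOneEqUnitaryCentralizer
import HarnessLib

/-!
# Moonen–Zarhin's «if `m ≥ 2` … then we simply have `Δ = D`» for ALL powers: `B(A^m) ⊗ ℂ = End⁰(A^m) ⊗ ℂ`
# and `G_div(A^m) = S(A^m) = S(A)` embedded diagonally, `m ≥ 2`, on the carrier

Layer `Literature/AlgebraicGeometry/HodgeTheory`; THEOREMS ONLY (no definition, no named fact; D-0026 net
debt 0). Sequel of the seat's `DivisorAlgebraSelfProduct` (the case `m = 2`: `B(A × A) ⊗ ℂ = End⁰(A × A) ⊗ ℂ`,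
and the Rosati adjoint inside `End⁰ ⊗ ℂ`, `exists_adjoint_mem_span_pullbackOne`) and of `DivisorLefschetzGroup`
(`symmetricPullbackSpan`, `divisorLefschetzGroup`, `divisorLefschetzGroup_eq_unitaryCentralizerGroup_of_forall_mem_adjoin`);
BY NAME the lane's `Milne1999/LefschetzCentraliserProducts` (Künneth in degree one with the sections, the
block-diagonal endomorphisms `prodBlockDiag s t = s ⊕ t`), `Milne1999/LefschetzCentraliserPowers` (the powers `A.powSucc a = A^{a+1}`, the classes
`powPolarizationClass A h a = Σᵢ prᵢ^* h`, the diagonal action `diagPow`, «every element of `C(A^{a+1})` is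
diagonal» `exists_eq_diagPow_of_mem_centralizerGroup`, the factor retraction `exists_section_powSucc`),
`Milne1999/LefschetzGroupProducts` (block Gram formula) and `Milne1999/SpecialLefschetzGroupOneEqUnitaryCentralizer`
§3–§4 (the hypotheses `Σ prᵢ^* h ∈ B¹`, `(Σ prᵢ^* h)^{dim} ≠ 0`, `Q` non-degenerate propagate along powers).

## The print

B. J. J. Moonen, Yu. G. Zarhin, *Weil classes on abelian varieties*, J. reine angew. Math. **496** (1998)
83–92 = arXiv:alg-geom/9612017 [MoonenZarhin1998WeilClasses], §1 (held text `paper:arxiv-alg-geom_9612017`,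
chunk p0002 L68–L80), VERBATIM: «From Table 1 we see that in all cases there is a simple `ℚ`-subalgebra
`Δ ⊆ D = End⁰(Y)` such that `∗` restricts to a positive involution on `Δ`, and such that `G_div(X)` is the
centralizer of `Δ` in `SP(V_Y, φ_Y)`, embedded diagonally into `SP(V, φ)`. (In fact, if `m ≥ 2` or if `X` is of
type 1 or 2, then we simply have `Δ = D`. If `m = 1` then `Δ = B`.)» (`X = Y^m`; `B ⊆ End⁰(X) = Mat_m(D)` the
subalgebra generated by the Rosati-symmetric elements, `G_div(X) = Gl_B(V) ∩ SP(V, φ)`; chunk p0003: «We have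
`B = Mat_m(D)`»), together with Milne 1999 §1 p. 643 «the diagonal action of `C(A)` on `rV(A)` identifies `C(A)`
with `C(A^r)`».

## What is proved (on the carrier, for ANY complex abelian variety `A` in the rôle of `Y` — simplicity is not used)

* Part 1 (`X × A` for any `X`): the projector `e = (pr_X ≫ ι_X)^* = 1 ⊕ 0` onto `pr_X^* H¹(X)` and the block
  embedding `S ↦ S ⊕ 0 = pr_X^* ∘ S ∘ ι_X^*` of `End_ℂ H¹(X(ℂ); ℂ)` into `End_ℂ H¹((X × A)(ℂ); ℂ)` (the lane's
  `Milne1999.prodBlockDiag S 0`): multiplicative, carries `End⁰(X) ⊗ ℂ` into `End⁰(X × A) ⊗ ℂ`,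
  `Q_{h_X}`-self-adjoint into `Q_H`-self-adjoint (`H = pr_X^* h_X + pr_A^* h`; the block Gram formula), hence
  `B(X) ⊗ ℂ` into `B(X × A) ⊗ ℂ` (`prodBlockDiag_zero_mem_adjoin_symmetricPullbackSpan_prod`).
* Part 2 (any `Y`, the mechanism of the print's Table 1 in invariant form): for a `Q_H`-symmetric idempotent
  `e ∈ S_λ(Y) ⊗ ℂ` and any `T ∈ End⁰(Y) ⊗ ℂ` with Rosati adjoint `T†`, the element `e T (1−e) + (1−e) T† e` is
  Rosati-symmetric, so the OFF-DIAGONAL CORNERS `e T (1−e)`, `(1−e) T e` lie in `B(Y) ⊗ ℂ`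
  (`mul_mul_one_sub_mem_adjoin_symmetricPullbackSpan`, `one_sub_mul_mul_mem_adjoin_symmetricPullbackSpan`).
* Part 3 (the step `X ↦ X × A` when `A` is a retract of `X`, `j ≫ q = 𝟙_A`, and `B(X) ⊗ ℂ = End⁰(X) ⊗ ℂ`):
  every `ψ^*`, `ψ ∈ End(X × A)`, lies in `B(X × A) ⊗ ℂ` — `ψ^* = eψ^*e + eψ^*(1−e) + (1−e)ψ^*e + (1−e)ψ^*(1−e)`, the
  first corner is the block embedding of `(ι_X ≫ ψ ≫ pr_X)^* ∈ B(X) ⊗ ℂ`, the two off-diagonal corners are Part 2,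
  and the last corner is the PRODUCT of the two off-diagonal corners `(pr_A ≫ φ ≫ j ≫ ι_X)^*` and
  `(pr_X ≫ q ≫ ι_A)^*` (`φ = ι_A ≫ ψ ≫ pr_A`) (`pullbackOne_prod_mem_adjoin_symmetricPullbackSpan_of_retract`).
* Part 4 (induction on `m`, base `m = 2` = `DivisorAlgebraSelfProduct`): for `0 < dim A`, `h ∈ B¹(A) ⊗ ℂ` with `Q_h`
  non-degenerate and `h^{dim A} ≠ 0`, and every `a`, with `X = A^{a+2} = A.powSucc (a+1)` and
  `H = Σᵢ prᵢ^* h = powPolarizationClass A h (a+1)`: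
  **`pullbackOne_powSucc_mem_adjoin_symmetricPullbackSpan`** (every `ψ^*`, `ψ ∈ End(A^{a+2})`, lies in
  `B(A^{a+2}) ⊗ ℂ`), **`adjoin_symmetricPullbackSpan_powSucc_eq_span`** («`B = Mat_m(D)`»: `B ⊗ ℂ = End⁰(A^{a+2}) ⊗ ℂ`),
  **`divisorLefschetzGroup_powSucc_eq_unitaryCentralizerGroup`** (`G_div(A^{a+2})(H) = S(A^{a+2})(H)`), and
  «embedded diagonally»: `diagPow_mem_divisorLefschetzGroup_powSucc` / **`exists_eq_diagPow_of_mem_divisorLefschetzGroup_powSucc`**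
  / `mem_divisorLefschetzGroup_powSucc_iff_exists_diagPow` — `G_div(A^{a+2})(H)(ℂ)` is exactly the set of diagonal
  `u^{⊕(a+2)}`, `u ∈ S(A)(h)(ℂ)`.

NOT here: `m = 1` (`Δ = B`), Table 1 by Albert type, isogenous `X ∼ Y^m` (only the powers themselves), `G_div`
as an algebraic group over `ℚ`; nothing about the Hodge conjecture.

## References

* [MoonenZarhin1998WeilClasses] B. J. J. Moonen, Yu. G. Zarhin, J. reine angew. Math. 496 (1998) =
  arXiv:alg-geom/9612017, §1 (chunk p0002 L53–L80: `S_λ`, `B`, `G_div(X)`, «if `m ≥ 2` … `Δ = D`»; chunk p0003: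
  «`B = Mat_m(D)`»).
* [Milne1999LefschetzClasses] J. S. Milne, *Lefschetz classes on abelian varieties*, Duke Math. J. 96 (1999), §1
  pp. 642–644 (`β ↦ β†`, `C(A)`, `C(A^r) = C(A)` diagonally, the divisor `Σ A × ⋯ × Dᵢ × ⋯ × A`, `S(A)`).
* [LangeBirkenhake1992] H. Lange, Ch. Birkenhake, *Complex Abelian Varieties*, §5.1 (Rosati = adjoint), §5.3
  (products of polarized abelian varieties).
* [MumfordAV1970] D. Mumford, *Abelian Varieties*, §21 (the Rosati involution of `Y^m`, `α ↦ ᵗα*`).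
* [HatcherAT2002] A. Hatcher, *Algebraic Topology*, §3.2 Thm. 3.16 (Künneth).

## Provenance

Lane `lit-hodgefound` (Track 2, Layer A), prover seat `lit-hodgefound-p21` (generation 15), row g15-#2; completes
row g15-#1 (`m = 2`) to the print's «`m ≥ 2`».
-/

noncomputable section

open CategoryTheory
open Literature.AlgebraicTopology.SingularHomology
open Literature.AlgebraicGeometry.Motives
open Literature.AlgebraicGeometry.VanGeemen1994 (pullbackOne hodgeClassSpan)
open Literature.AlgebraicGeometry.Milne1999
open Literature.Geometry.Kaehler (lefschetzPow)

namespace Literature.AlgebraicGeometry.HodgeTheory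

/-- `(f^*).hom c = f^* c` (the two spellings of applying a pull-back). [folklore] -/
private theorem hom_apply' {Y Z : SchemeOver ℂ} (f : Y ⟶ Z) (k : ℕ) (c : complexBetti Z k) :
    (complexBetti.map f k).hom c = complexBetti.map f k c := rfl

/-- `1 ∈ S_λ ⊗ ℂ`: the identity is a (self-adjoint) pull-back combination. [cite: MoonenZarhin1998WeilClasses, §1 (chunk p0002: S_λ)] -/
theorem one_mem_symmetricPullbackSpan {Y : AbelianVariety ℂ} {H : complexBetti Y.X 2} :
    (1 : Module.End ℂ (complexBetti Y.X 1)) ∈ symmetricPullbackSpan Y H :=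
  ⟨mem_bicommutant_iff_mem_span.1 (Subalgebra.one_mem _), fun _ _ ↦ rfl⟩

/-! ## Part 1. The projector onto `pr_X^* H¹(X)` and the block embedding `S ↦ pr_X^* ∘ S ∘ ι_X^*` on `X × A` -/

section Prod

variable {X A : AbelianVariety ℂ} {hX : complexBetti X.X 2} {h : complexBetti A.X 2}

/-- `ι_X^* pr_X^* x = x`. [cite: HatcherAT2002, §3.2 Thm. 3.16] -/
private theorem secX_X (x : complexBetti X.X 1) :
    complexBetti.map (AbelianVariety.prodLift (𝟙 X) (0 : X ⟶ A)).hom.hom.hom 1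
      (complexBetti.map (AbelianVariety.fst X A).hom.hom.hom 1 x) = x :=
  map_inlSection_map_fst_one x

/-- `ι_A^* pr_A^* y = y`. [cite: HatcherAT2002, §3.2 Thm. 3.16] -/
private theorem secA_A (y : complexBetti A.X 1) :
    complexBetti.map (AbelianVariety.prodLift (0 : A ⟶ X) (𝟙 A)).hom.hom.hom 1
      (complexBetti.map (AbelianVariety.snd X A).hom.hom.hom 1 y) = y :=
  map_inrSection_map_snd_one y

/-- **The two projectors sum to the identity**: `(pr_X ≫ ι_X)^* + (pr_A ≫ ι_A)^* = 1` on
`H¹((X × A)(ℂ); ℂ) = pr_X^* H¹(X) ⊕ pr_A^* H¹(A)` (Künneth in degree one). [cite: HatcherAT2002, §3.2 Thm. 3.16]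
[cite: Milne1999LefschetzClasses, §1 p. 643 (V(A₁ × A₂) = V(A₁) ⊕ V(A₂))] -/
theorem pullbackOne_fst_inl_add_pullbackOne_snd_inr :
    pullbackOne (X.prod A) (AbelianVariety.fst X A ≫ AbelianVariety.prodLift (𝟙 X) (0 : X ⟶ A)) +
        pullbackOne (X.prod A) (AbelianVariety.snd X A ≫ AbelianVariety.prodLift (0 : A ⟶ X) (𝟙 A)) = 1 := by
  refine LinearMap.ext fun x ↦ ?_
  simp only [LinearMap.add_apply, Module.End.one_apply, hom_apply']
  rw [complexBetti_map_comp_apply, complexBetti_map_comp_apply]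
  exact (eq_map_fst_add_map_snd_one x).symm

/-- `1 - (pr_X ≫ ι_X)^* = (pr_A ≫ ι_A)^*`. [cite: HatcherAT2002, §3.2 Thm. 3.16] -/
theorem one_sub_pullbackOne_fst_inl :
    (1 : Module.End ℂ (complexBetti (X.prod A).X 1)) -
        pullbackOne (X.prod A) (AbelianVariety.fst X A ≫ AbelianVariety.prodLift (𝟙 X) (0 : X ⟶ A)) =
      pullbackOne (X.prod A) (AbelianVariety.snd X A ≫ AbelianVariety.prodLift (0 : A ⟶ X) (𝟙 A)) := by
  rw [← pullbackOne_fst_inl_add_pullbackOne_snd_inr (X := X) (A := A), add_sub_cancel_left]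

/-- **The projector `(pr_X ≫ ι_X)^*` is idempotent.** [cite: HatcherAT2002, §3.2 Thm. 3.16] -/
theorem pullbackOne_fst_inl_mul_self :
    pullbackOne (X.prod A) (AbelianVariety.fst X A ≫ AbelianVariety.prodLift (𝟙 X) (0 : X ⟶ A)) *
        pullbackOne (X.prod A) (AbelianVariety.fst X A ≫ AbelianVariety.prodLift (𝟙 X) (0 : X ⟶ A)) =
      pullbackOne (X.prod A) (AbelianVariety.fst X A ≫ AbelianVariety.prodLift (𝟙 X) (0 : X ⟶ A)) := by
  refine LinearMap.ext fun x ↦ ?_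
  simp only [Module.End.mul_apply, hom_apply']
  rw [complexBetti_map_comp_apply, complexBetti_map_comp_apply, secX_X]

/-- **`1 ⊕ 0 = (pr_X ≫ ι_X)^*`**: the block-diagonal endomorphism `prodBlockDiag 1 0` of the lane's
`Milne1999/LefschetzCentraliserProducts` is the projector onto `pr_X^* H¹(X)`. [cite: HatcherAT2002, §3.2 Thm. 3.16]
[cite: Milne1999LefschetzClasses, §1 p. 643 (V(A₁ × A₂) = V(A₁) ⊕ V(A₂))] -/
theorem prodBlockDiag_one_zero :
    prodBlockDiag (1 : Module.End ℂ (complexBetti X.X 1)) (0 : Module.End ℂ (complexBetti A.X 1)) =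
      pullbackOne (X.prod A) (AbelianVariety.fst X A ≫ AbelianVariety.prodLift (𝟙 X) (0 : X ⟶ A)) := by
  refine LinearMap.ext fun x ↦ ?_
  rw [prodBlockDiag_apply, LinearMap.zero_apply, map_zero, add_zero, Module.End.one_apply]
  simp only [hom_apply']
  rw [complexBetti_map_comp_apply]

/-- **The block embedding `S ↦ S ⊕ 0 = pr_X^* ∘ S ∘ ι_X^*` is multiplicative** (`ι_X^* pr_X^* = 1`; the lane's
`prodBlockDiag_mul`). [cite: Milne1999LefschetzClasses, §1 p. 643] [cite: HatcherAT2002, §3.2 Thm. 3.16] -/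
theorem prodBlockDiag_zero_mul_prodBlockDiag_zero (S T : Module.End ℂ (complexBetti X.X 1)) :
    prodBlockDiag S (0 : Module.End ℂ (complexBetti A.X 1)) * prodBlockDiag T 0 = prodBlockDiag (S * T) 0 := by
  rw [← prodBlockDiag_mul, mul_zero]

/-- **The block embedding carries `End⁰(X) ⊗ ℂ` into `End⁰(X × A) ⊗ ℂ`**: `φ^* ⊕ 0 = (pr_X ≫ φ ≫ ι_X)^*`.
[cite: Milne1999LefschetzClasses, §1 p. 643] -/
theorem prodBlockDiag_zero_mem_span {S : Module.End ℂ (complexBetti X.X 1)}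
    (hS : S ∈ Submodule.span ℂ (Set.range fun φ : X ⟶ X ↦ pullbackOne X φ)) :
    prodBlockDiag S (0 : Module.End ℂ (complexBetti A.X 1)) ∈
      Submodule.span ℂ (Set.range fun ψ : X.prod A ⟶ X.prod A ↦ pullbackOne (X.prod A) ψ) := by
  induction hS using Submodule.span_induction with
  | mem S hS =>
    obtain ⟨φ, rfl⟩ := hS
    refine Submodule.subset_span ⟨AbelianVariety.fst X A ≫ φ ≫ AbelianVariety.prodLift (𝟙 X) (0 : X ⟶ A), ?_⟩
    refine LinearMap.ext fun x ↦ ?_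
    rw [prodBlockDiag_apply, LinearMap.zero_apply, map_zero, add_zero]
    simp only [hom_apply']
    rw [complexBetti_map_comp_apply, complexBetti_map_comp_apply]
  | zero =>
    rw [show prodBlockDiag (0 : Module.End ℂ (complexBetti X.X 1)) (0 : Module.End ℂ (complexBetti A.X 1)) = 0 from
      LinearMap.ext fun x ↦ by rw [prodBlockDiag_apply, LinearMap.zero_apply, LinearMap.zero_apply, map_zero,
        map_zero, add_zero, LinearMap.zero_apply]]
    exact Submodule.zero_mem _
  | add S S' _ _ hS hS' =>
    rw [show prodBlockDiag (S + S') (0 : Module.End ℂ (complexBetti A.X 1)) = prodBlockDiag S 0 + prodBlockDiag S' 0 from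
      LinearMap.ext fun x ↦ by simp only [prodBlockDiag_apply, LinearMap.add_apply, LinearMap.zero_apply, map_zero,
        map_add, add_zero]]
    exact Submodule.add_mem _ hS hS'
  | smul c S _ hS =>
    rw [show prodBlockDiag (c • S) (0 : Module.End ℂ (complexBetti A.X 1)) = c • prodBlockDiag S 0 from
      LinearMap.ext fun x ↦ by simp only [prodBlockDiag_apply, LinearMap.smul_apply, LinearMap.zero_apply, map_zero,
        map_smul, add_zero]]
    exact Submodule.smul_mem _ c hS

/-- **The `X`–`X` block of `Q_H`, left form**: `Q_H(pr_X^* b, y) = C(dim X + dim A − 1, dim X − 1) ·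
pr_X^* Q_{h_X}(b, ι_X^* y) ⌣ pr_A^* h^{dim A}` (the block Gram formula; the mixed block vanishes).
[cite: Milne1999LefschetzClasses, §1 p. 643] [cite: LangeBirkenhake1992, §5.3] -/
theorem polarizationPairingOne_prod_map_fst_left (hX0 : 0 < X.dim) (hA0 : 0 < A.dim) (b : complexBetti X.X 1)
    (y : complexBetti (X.prod A).X 1) :
    polarizationPairingOne (X.prod A).X (prodPolarizationClass X A hX h) ((X.prod A).dim - 1)
        (complexBetti.map (AbelianVariety.fst X A).hom.hom.hom 1 b) y =
      ((((X.prod A).dim - 1).choose (X.dim - 1) : ℕ) : ℂ) • cupProduct (prod_topDeg_eq hX0 hA0)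
        (complexBetti.map (AbelianVariety.fst X A).hom.hom.hom (2 + 2 * (X.dim - 1))
          (polarizationPairingOne X.X hX (X.dim - 1) b
            (complexBetti.map (AbelianVariety.prodLift (𝟙 X) (0 : X ⟶ A)).hom.hom.hom 1 y)))
        (complexBetti.map (AbelianVariety.snd X A).hom.hom.hom (2 + 2 * (A.dim - 1))
          (lefschetzPow h (A.dim - 1) 2 h)) := by
  conv_lhs => rw [eq_map_fst_add_map_snd_one y]
  rw [map_add, polarizationPairingOne_prod_map_fst_map_fst hX h hX0 hA0,
    polarizationPairingOne_prod_map_fst_map_snd hX h hX0 hA0, add_zero]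

/-- **The `X`–`X` block of `Q_H`, right form**: `Q_H(x, pr_X^* b) = C(dim X + dim A − 1, dim X − 1) ·
pr_X^* Q_{h_X}(ι_X^* x, b) ⌣ pr_A^* h^{dim A}`. [cite: Milne1999LefschetzClasses, §1 p. 643] [cite: LangeBirkenhake1992, §5.3] -/
theorem polarizationPairingOne_prod_map_fst_right (hX0 : 0 < X.dim) (hA0 : 0 < A.dim)
    (x : complexBetti (X.prod A).X 1) (b : complexBetti X.X 1) :
    polarizationPairingOne (X.prod A).X (prodPolarizationClass X A hX h) ((X.prod A).dim - 1) x
        (complexBetti.map (AbelianVariety.fst X A).hom.hom.hom 1 b) =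
      ((((X.prod A).dim - 1).choose (X.dim - 1) : ℕ) : ℂ) • cupProduct (prod_topDeg_eq hX0 hA0)
        (complexBetti.map (AbelianVariety.fst X A).hom.hom.hom (2 + 2 * (X.dim - 1))
          (polarizationPairingOne X.X hX (X.dim - 1)
            (complexBetti.map (AbelianVariety.prodLift (𝟙 X) (0 : X ⟶ A)).hom.hom.hom 1 x) b))
        (complexBetti.map (AbelianVariety.snd X A).hom.hom.hom (2 + 2 * (A.dim - 1))
          (lefschetzPow h (A.dim - 1) 2 h)) := by
  conv_lhs => rw [eq_map_fst_add_map_snd_one x]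
  rw [LinearMap.map_add₂, polarizationPairingOne_prod_map_fst_map_fst hX h hX0 hA0,
    polarizationPairingOne_prod_map_snd_map_fst hX h hX0 hA0, add_zero]

/-- **The block embedding carries `Q_{h_X}`-self-adjoint operators to `Q_H`-self-adjoint ones** («the involution
`D` defines on `C(A)` is the restriction of the product of the involutions on the `C(Aᵢ)`», Milne §1 p. 643).
[cite: Milne1999LefschetzClasses, §1 p. 643] [cite: LangeBirkenhake1992, §5.3] -/
theorem prodBlockDiag_zero_comm_polarizationPairingOne (hX0 : 0 < X.dim) (hA0 : 0 < A.dim)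
    {S : Module.End ℂ (complexBetti X.X 1)}
    (hS : ∀ b b' : complexBetti X.X 1, polarizationPairingOne X.X hX (X.dim - 1) (S b) b' =
      polarizationPairingOne X.X hX (X.dim - 1) b (S b')) (x y : complexBetti (X.prod A).X 1) :
    polarizationPairingOne (X.prod A).X (prodPolarizationClass X A hX h) ((X.prod A).dim - 1)
        (prodBlockDiag S (0 : Module.End ℂ (complexBetti A.X 1)) x) y =
      polarizationPairingOne (X.prod A).X (prodPolarizationClass X A hX h) ((X.prod A).dim - 1) x
        (prodBlockDiag S (0 : Module.End ℂ (complexBetti A.X 1)) y) := by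
  rw [prodBlockDiag_apply, prodBlockDiag_apply, LinearMap.zero_apply, LinearMap.zero_apply, map_zero, add_zero,
    add_zero, polarizationPairingOne_prod_map_fst_left hX0 hA0, polarizationPairingOne_prod_map_fst_right hX0 hA0, hS]

/-- **The block embedding carries `S_λ(X) ⊗ ℂ` into `S_λ(X × A) ⊗ ℂ`** (`λ` the product polarization class
`pr_X^* h_X + pr_A^* h`). [cite: MoonenZarhin1998WeilClasses, §1 (chunk p0002: S_λ, «α† = (α*_{ji})»)]
[cite: Milne1999LefschetzClasses, §1 p. 643] -/
theorem prodBlockDiag_zero_mem_symmetricPullbackSpan_prod (hX0 : 0 < X.dim) (hA0 : 0 < A.dim)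
    {S : Module.End ℂ (complexBetti X.X 1)} (hS : S ∈ symmetricPullbackSpan X hX) :
    prodBlockDiag S (0 : Module.End ℂ (complexBetti A.X 1)) ∈
      symmetricPullbackSpan (X.prod A) (prodPolarizationClass X A hX h) :=
  ⟨prodBlockDiag_zero_mem_span hS.1, prodBlockDiag_zero_comm_polarizationPairingOne hX0 hA0 hS.2⟩

/-- **The projector `(pr_X ≫ ι_X)^* = 1 ⊕ 0` lies in `S_λ(X × A) ⊗ ℂ`** (a Rosati-symmetric idempotent: the
diagonal matrix unit of the first factor). [cite: MoonenZarhin1998WeilClasses, §1 (chunk p0002: S_λ, «α† = (α*_{ji})»)]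
[cite: Milne1999LefschetzClasses, §1 p. 643] -/
theorem projFst_mem_symmetricPullbackSpan_prod (hX0 : 0 < X.dim) (hA0 : 0 < A.dim) :
    pullbackOne (X.prod A) (AbelianVariety.fst X A ≫ AbelianVariety.prodLift (𝟙 X) (0 : X ⟶ A)) ∈
      symmetricPullbackSpan (X.prod A) (prodPolarizationClass X A hX h) := by
  rw [← prodBlockDiag_one_zero]
  exact prodBlockDiag_zero_mem_symmetricPullbackSpan_prod hX0 hA0 one_mem_symmetricPullbackSpan

/-- **The block embedding carries `B(X) ⊗ ℂ` into `B(X × A) ⊗ ℂ`**: the subalgebra generated by `S_λ(X) ⊗ ℂ` is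
mapped into the subalgebra generated by `S_λ(X × A) ⊗ ℂ` (the embedding is linear and multiplicative and sends
`1` to the symmetric projector `1 ⊕ 0`). [cite: MoonenZarhin1998WeilClasses, §1 (chunk p0002: B)] [cite: Milne1999LefschetzClasses, §1 p. 643] -/
theorem prodBlockDiag_zero_mem_adjoin_symmetricPullbackSpan_prod (hX0 : 0 < X.dim) (hA0 : 0 < A.dim)
    {T : Module.End ℂ (complexBetti X.X 1)}
    (hT : T ∈ Algebra.adjoin ℂ (symmetricPullbackSpan X hX : Set (Module.End ℂ (complexBetti X.X 1)))) :
    prodBlockDiag T (0 : Module.End ℂ (complexBetti A.X 1)) ∈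
      Algebra.adjoin ℂ (symmetricPullbackSpan (X.prod A) (prodPolarizationClass X A hX h) :
        Set (Module.End ℂ (complexBetti (X.prod A).X 1))) := by
  induction hT using Algebra.adjoin_induction with
  | mem S hS => exact Algebra.subset_adjoin (prodBlockDiag_zero_mem_symmetricPullbackSpan_prod hX0 hA0 hS)
  | algebraMap r =>
    rw [Algebra.algebraMap_eq_smul_one,
      show prodBlockDiag (r • (1 : Module.End ℂ (complexBetti X.X 1))) (0 : Module.End ℂ (complexBetti A.X 1)) =
          r • prodBlockDiag 1 0 from
        LinearMap.ext fun x ↦ by simp only [prodBlockDiag_apply, LinearMap.smul_apply, LinearMap.zero_apply,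
          map_zero, map_smul, add_zero]]
    exact Subalgebra.smul_mem _ (Algebra.subset_adjoin
      (prodBlockDiag_zero_mem_symmetricPullbackSpan_prod hX0 hA0 one_mem_symmetricPullbackSpan)) r
  | add S T _ _ hS hT =>
    rw [show prodBlockDiag (S + T) (0 : Module.End ℂ (complexBetti A.X 1)) = prodBlockDiag S 0 + prodBlockDiag T 0 from
      LinearMap.ext fun x ↦ by simp only [prodBlockDiag_apply, LinearMap.add_apply, LinearMap.zero_apply, map_zero,
        map_add, add_zero]]
    exact add_mem hS hT
  | mul S T _ _ hS hT => rw [← prodBlockDiag_zero_mul_prodBlockDiag_zero]; exact mul_mem hS hT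

end Prod

/-! ## Part 2. The off-diagonal corners of a symmetric idempotent lie in `B ⊗ ℂ` -/

section Corner

variable {Y : AbelianVariety ℂ} {H : complexBetti Y.X 2}

/-- **The off-diagonal corner `e T (1 − e)` lies in `B(Y) ⊗ ℂ`** for a `Q_H`-symmetric idempotent
`e ∈ S_λ(Y) ⊗ ℂ` and any `T ∈ End⁰(Y) ⊗ ℂ` (`H ∈ B¹(Y) ⊗ ℂ`, `Q_H` non-degenerate): with the Rosati adjoint
`T† ∈ End⁰(Y) ⊗ ℂ` the element `s = e T (1 − e) + (1 − e) T† e` is Rosati-symmetric (the print's `†`-hermitian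
matrices `E_{ij}(d) + E_{ji}(d*)` in invariant form), and `e T (1 − e) = s · (1 − e)`.
[cite: MoonenZarhin1998WeilClasses, §1 (chunk p0002: S_λ, B, «α† = (α*_{ji})», Table 1)] [cite: MumfordAV1970, §21]
[cite: Milne1999LefschetzClasses, §1 pp. 642–643] -/
theorem mul_mul_one_sub_mem_adjoin_symmetricPullbackSpan (hH : H ∈ hodgeClassSpan Y.dim Y.X 1)
    (hnd : ∀ x : complexBetti Y.X 1, (∀ y, polarizationPairingOne Y.X H (Y.dim - 1) x y = 0) → x = 0)
    {e T : Module.End ℂ (complexBetti Y.X 1)} (he : e ∈ symmetricPullbackSpan Y H) (he2 : e * e = e)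
    (hT : T ∈ Submodule.span ℂ (Set.range fun φ : Y ⟶ Y ↦ pullbackOne Y φ)) :
    e * T * (1 - e) ∈ Algebra.adjoin ℂ (symmetricPullbackSpan Y H : Set (Module.End ℂ (complexBetti Y.X 1))) := by
  obtain ⟨T', hT'm, hT'⟩ := exists_adjoint_mem_span_pullbackOne hH hnd hT
  -- `End⁰(Y) ⊗ ℂ` is a subalgebra (the bicommutant `E''`)
  have hmul : ∀ {S S' : Module.End ℂ (complexBetti Y.X 1)},
      S ∈ Submodule.span ℂ (Set.range fun φ : Y ⟶ Y ↦ pullbackOne Y φ) →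
      S' ∈ Submodule.span ℂ (Set.range fun φ : Y ⟶ Y ↦ pullbackOne Y φ) →
      S * S' ∈ Submodule.span ℂ (Set.range fun φ : Y ⟶ Y ↦ pullbackOne Y φ) := fun hS hS' ↦
    mem_bicommutant_iff_mem_span.1
      (Subalgebra.mul_mem _ (mem_bicommutant_iff_mem_span.2 hS) (mem_bicommutant_iff_mem_span.2 hS'))
  have h1e : 1 - e ∈ Submodule.span ℂ (Set.range fun φ : Y ⟶ Y ↦ pullbackOne Y φ) :=
    Submodule.sub_mem _ (mem_bicommutant_iff_mem_span.1 (Subalgebra.one_mem _)) he.1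
  -- the adjoint relations
  have hes := he.2
  have h1es : ∀ x y : complexBetti Y.X 1, polarizationPairingOne Y.X H (Y.dim - 1) ((1 - e) x) y =
      polarizationPairingOne Y.X H (Y.dim - 1) x ((1 - e) y) := fun x y ↦ by
    simp only [LinearMap.sub_apply, Module.End.one_apply, map_sub, hes]
  have hT'' := adjoint_adjoint_polarizationPairingOne hT'
  -- the hermitian element
  have hs : e * T * (1 - e) + (1 - e) * T' * e ∈ symmetricPullbackSpan Y H := by
    refine ⟨Submodule.add_mem _ (hmul (hmul he.1 hT) h1e) (hmul (hmul h1e hT'm) he.1), fun x y ↦ ?_⟩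
    simp only [LinearMap.add_apply, Module.End.mul_apply, map_add]
    rw [hes, hT', h1es, h1es, hT'', hes]
    exact add_comm _ _
  -- `e (1 - e) = 0`, `(1 - e)² = 1 - e`
  have h3 : e * (1 - e) = 0 := by rw [mul_sub, mul_one, he2, sub_self]
  have h4 : (1 - e) * (1 - e) = 1 - e := by rw [mul_sub, mul_one, sub_mul, one_mul, he2, sub_self, sub_zero]
  have key : e * T * (1 - e) = (e * T * (1 - e) + (1 - e) * T' * e) * (1 - e) := by
    rw [add_mul, mul_assoc (e * T) (1 - e) (1 - e), h4, mul_assoc ((1 - e) * T') e (1 - e), h3, mul_zero,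
      add_zero]
  rw [key]
  exact Subalgebra.mul_mem _ (Algebra.subset_adjoin hs)
    (Subalgebra.sub_mem _ (Subalgebra.one_mem _) (Algebra.subset_adjoin he))

/-- **The other off-diagonal corner `(1 − e) T e` lies in `B(Y) ⊗ ℂ`** (the previous statement for the
symmetric idempotent `1 − e`). [cite: MoonenZarhin1998WeilClasses, §1 (chunk p0002: S_λ, B, Table 1)]
[cite: Milne1999LefschetzClasses, §1 pp. 642–643] -/
theorem one_sub_mul_mul_mem_adjoin_symmetricPullbackSpan (hH : H ∈ hodgeClassSpan Y.dim Y.X 1)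
    (hnd : ∀ x : complexBetti Y.X 1, (∀ y, polarizationPairingOne Y.X H (Y.dim - 1) x y = 0) → x = 0)
    {e T : Module.End ℂ (complexBetti Y.X 1)} (he : e ∈ symmetricPullbackSpan Y H) (he2 : e * e = e)
    (hT : T ∈ Submodule.span ℂ (Set.range fun φ : Y ⟶ Y ↦ pullbackOne Y φ)) :
    (1 - e) * T * e ∈ Algebra.adjoin ℂ (symmetricPullbackSpan Y H : Set (Module.End ℂ (complexBetti Y.X 1))) := by
  have he' : 1 - e ∈ symmetricPullbackSpan Y H := Submodule.sub_mem _ one_mem_symmetricPullbackSpan he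
  have he2' : (1 - e) * (1 - e) = 1 - e := by
    rw [mul_sub, mul_one, sub_mul, one_mul, he2, sub_self, sub_zero]
  have key := mul_mul_one_sub_mem_adjoin_symmetricPullbackSpan hH hnd he' he2' hT
  rwa [sub_sub_cancel] at key

end Corner

/-! ## Part 3. The step `X ↦ X × A` when `A` is a retract of `X` -/

section Step

variable {X A : AbelianVariety ℂ} {hX : complexBetti X.X 2} {h : complexBetti A.X 2}

/-- **The inductive step.** Let `X`, `A` be complex abelian varieties of positive dimension with classes
`h_X ∈ B¹(X) ⊗ ℂ`, `h ∈ B¹(A) ⊗ ℂ`, both pairings non-degenerate and both top powers non-zero, such that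
`B(X) ⊗ ℂ = End⁰(X) ⊗ ℂ` (every pull-back combination of `X` lies in the subalgebra generated by `S_λ(X) ⊗ ℂ`) and
`A` is a retract of `X` (`j ≫ q = 𝟙_A`). Then for the product class `H = pr_X^* h_X + pr_A^* h` every pull-back
`ψ^*`, `ψ ∈ End(X × A)`, lies in `B(X × A) ⊗ ℂ`: with `e = (pr_X ≫ ι_X)^*`,
`ψ^* = eψ^*e + eψ^*(1−e) + (1−e)ψ^*e + (1−e)ψ^*(1−e)`; the first corner is the block embedding
`(ι_X ≫ ψ ≫ pr_X)^* ⊕ 0` (Part 1), the off-diagonal corners are Part 2, and the last corner is the product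
`(pr_A ≫ φ ≫ j ≫ ι_X)^* · (pr_X ≫ q ≫ ι_A)^*` of two off-diagonal corners (`φ = ι_A ≫ ψ ≫ pr_A`, `j^* q^* = 1`).
[cite: MoonenZarhin1998WeilClasses, §1 (chunk p0002 L68–L80 «if m ≥ 2 … Δ = D»; chunk p0003 «B = Mat_m(D)»)]
[cite: Milne1999LefschetzClasses, §1 p. 643] -/
theorem pullbackOne_prod_mem_adjoin_symmetricPullbackSpan_of_retract (hX0 : 0 < X.dim) (hA0 : 0 < A.dim)
    (hHX : hX ∈ hodgeClassSpan X.dim X.X 1) (hh : h ∈ hodgeClassSpan A.dim A.X 1)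
    (hndX : ∀ x : complexBetti X.X 1, (∀ y, polarizationPairingOne X.X hX (X.dim - 1) x y = 0) → x = 0)
    (hnd : ∀ x : complexBetti A.X 1, (∀ y, polarizationPairingOne A.X h (A.dim - 1) x y = 0) → x = 0)
    (hXtop : lefschetzPow hX (X.dim - 1) 2 hX ≠ 0) (htop : lefschetzPow h (A.dim - 1) 2 h ≠ 0)
    (IH : ∀ T ∈ Submodule.span ℂ (Set.range fun φ : X ⟶ X ↦ pullbackOne X φ),
      T ∈ Algebra.adjoin ℂ (symmetricPullbackSpan X hX : Set (Module.End ℂ (complexBetti X.X 1))))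
    {j : A ⟶ X} {q : X ⟶ A} (hjq : j ≫ q = 𝟙 A) (ψ : X.prod A ⟶ X.prod A) :
    pullbackOne (X.prod A) ψ ∈ Algebra.adjoin ℂ
      (symmetricPullbackSpan (X.prod A) (prodPolarizationClass X A hX h) :
        Set (Module.End ℂ (complexBetti (X.prod A).X 1))) := by
  have hHY : prodPolarizationClass X A hX h ∈ hodgeClassSpan (X.prod A).dim (X.prod A).X 1 :=
    prodPolarizationClass_mem_hodgeClassSpan _ _ hHX hh
  have hndY : ∀ x : complexBetti (X.prod A).X 1,
      (∀ y, polarizationPairingOne (X.prod A).X (prodPolarizationClass X A hX h) ((X.prod A).dim - 1) x y = 0) →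
        x = 0 :=
    fun x hx ↦ eq_zero_of_forall_polarizationPairingOne_prod_eq_zero _ _ hX0 hA0 hXtop htop hndX hnd x hx
  -- the projector `e`
  set e : Module.End ℂ (complexBetti (X.prod A).X 1) :=
    pullbackOne (X.prod A) (AbelianVariety.fst X A ≫ AbelianVariety.prodLift (𝟙 X) (0 : X ⟶ A)) with he_def
  have he : e ∈ symmetricPullbackSpan (X.prod A) (prodPolarizationClass X A hX h) :=
    projFst_mem_symmetricPullbackSpan_prod hX0 hA0
  have he2 : e * e = e := pullbackOne_fst_inl_mul_self
  have h1e : (1 : Module.End ℂ (complexBetti (X.prod A).X 1)) - e =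
      pullbackOne (X.prod A) (AbelianVariety.snd X A ≫ AbelianVariety.prodLift (0 : A ⟶ X) (𝟙 A)) :=
    one_sub_pullbackOne_fst_inl
  have hψ : pullbackOne (X.prod A) ψ ∈
      Submodule.span ℂ (Set.range fun χ : X.prod A ⟶ X.prod A ↦ pullbackOne (X.prod A) χ) :=
    Submodule.subset_span ⟨ψ, rfl⟩
  -- the four corners
  have split : pullbackOne (X.prod A) ψ = e * pullbackOne (X.prod A) ψ * e + e * pullbackOne (X.prod A) ψ * (1 - e) +
      (1 - e) * pullbackOne (X.prod A) ψ * e + (1 - e) * pullbackOne (X.prod A) ψ * (1 - e) := by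
    simp only [mul_sub, sub_mul, mul_one, one_mul]
    abel
  rw [split]
  refine add_mem (add_mem (add_mem ?_ ?_) ?_) ?_
  · -- the `X`–`X` corner: the block embedding of `(ι_X ≫ ψ ≫ pr_X)^* ∈ B(X) ⊗ ℂ`
    have eq : e * pullbackOne (X.prod A) ψ * e =
        prodBlockDiag (pullbackOne X (AbelianVariety.prodLift (𝟙 X) (0 : X ⟶ A) ≫ ψ ≫ AbelianVariety.fst X A))
          (0 : Module.End ℂ (complexBetti A.X 1)) := by
      refine LinearMap.ext fun x ↦ ?_
      rw [prodBlockDiag_apply, LinearMap.zero_apply, map_zero, add_zero]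
      simp only [Module.End.mul_apply, he_def, hom_apply']
      rw [complexBetti_map_comp_apply, complexBetti_map_comp_apply, map_inl_map_map_fst_one]
    rw [eq]
    exact prodBlockDiag_zero_mem_adjoin_symmetricPullbackSpan_prod hX0 hA0 (IH _ (Submodule.subset_span ⟨_, rfl⟩))
  · exact mul_mul_one_sub_mem_adjoin_symmetricPullbackSpan hHY hndY he he2 hψ
  · exact one_sub_mul_mul_mem_adjoin_symmetricPullbackSpan hHY hndY he he2 hψ
  · -- the `A`–`A` corner is a product of two off-diagonal corners
    set U : Module.End ℂ (complexBetti (X.prod A).X 1) := pullbackOne (X.prod A)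
      (AbelianVariety.snd X A ≫ (AbelianVariety.prodLift (0 : A ⟶ X) (𝟙 A) ≫ ψ ≫ AbelianVariety.snd X A) ≫ j ≫
        AbelianVariety.prodLift (𝟙 X) (0 : X ⟶ A)) with hU
    set V : Module.End ℂ (complexBetti (X.prod A).X 1) := pullbackOne (X.prod A)
      (AbelianVariety.fst X A ≫ q ≫ AbelianVariety.prodLift (0 : A ⟶ X) (𝟙 A)) with hV
    have hUs : U ∈ Submodule.span ℂ (Set.range fun χ : X.prod A ⟶ X.prod A ↦ pullbackOne (X.prod A) χ) :=
      Submodule.subset_span ⟨_, rfl⟩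
    have hVs : V ∈ Submodule.span ℂ (Set.range fun χ : X.prod A ⟶ X.prod A ↦ pullbackOne (X.prod A) χ) :=
      Submodule.subset_span ⟨_, rfl⟩
    have hUV : (1 - e) * pullbackOne (X.prod A) ψ * (1 - e) = U * V := by
      rw [h1e]
      refine LinearMap.ext fun x ↦ ?_
      simp only [Module.End.mul_apply, hU, hV, hom_apply']
      repeat rw [complexBetti_map_comp_apply]
      rw [secX_X, map_map_one_of_comp_eq_id hjq]
    have hU' : (1 - e) * U * e = U := by
      rw [h1e]
      refine LinearMap.ext fun x ↦ ?_
      simp only [Module.End.mul_apply, hU, he_def, hom_apply']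
      repeat rw [complexBetti_map_comp_apply]
      rw [secX_X, secA_A]
    have hV' : e * V * (1 - e) = V := by
      rw [h1e]
      refine LinearMap.ext fun x ↦ ?_
      simp only [Module.End.mul_apply, hV, he_def, hom_apply']
      repeat rw [complexBetti_map_comp_apply]
      rw [secA_A, secX_X]
    rw [hUV]
    refine Subalgebra.mul_mem _ ?_ ?_
    · rw [← hU']; exact one_sub_mul_mul_mem_adjoin_symmetricPullbackSpan hHY hndY he he2 hUs
    · rw [← hV']; exact mul_mul_one_sub_mem_adjoin_symmetricPullbackSpan hHY hndY he he2 hVs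

end Step

/-! ## Part 4. All powers `A^m`, `m ≥ 2` -/

section Powers

variable {A : AbelianVariety ℂ} {h : complexBetti A.X 2}

/-- **Moonen–Zarhin 1998, §1 «if `m ≥ 2` … then we simply have `Δ = D`» / «`B = Mat_m(D)`», ALL `m ≥ 2`, on the
carrier.** For a complex abelian variety `A` of positive dimension, `h ∈ B¹(A) ⊗ ℂ` with `Q_h` non-degenerate on
`H¹(A(ℂ); ℂ)` and `h^{dim A} ≠ 0` (e.g. a polarization class), and every `a`, EVERY pull-back `ψ^*`,
`ψ ∈ End(A^{a+2})`, lies in `B(A^{a+2}) ⊗ ℂ = Algebra.adjoin ℂ (S_λ(A^{a+2}) ⊗ ℂ)` for the product polarization class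
`Σᵢ prᵢ^* h` (`A^{a+2} = A.powSucc (a+1)`, `powPolarizationClass A h (a+1)`). Induction on `a`: the base is the
self-product (`DivisorAlgebraSelfProduct`), the step is Part 3 with the last-factor retraction of
`Milne1999.exists_section_powSucc`. [cite: MoonenZarhin1998WeilClasses, §1 (chunk p0002 L68–L80; chunk p0003 «B = Mat_m(D)»)]
[cite: Milne1999LefschetzClasses, §1 p. 643] -/
theorem pullbackOne_powSucc_mem_adjoin_symmetricPullbackSpan (hA0 : 0 < A.dim)
    (hh : h ∈ hodgeClassSpan A.dim A.X 1)
    (hnd : ∀ x : complexBetti A.X 1, (∀ y, polarizationPairingOne A.X h (A.dim - 1) x y = 0) → x = 0)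
    (htop : lefschetzPow h (A.dim - 1) 2 h ≠ 0) :
    ∀ (a : ℕ) (ψ : A.powSucc (a + 1) ⟶ A.powSucc (a + 1)),
      pullbackOne (A.powSucc (a + 1)) ψ ∈ Algebra.adjoin ℂ
        (symmetricPullbackSpan (A.powSucc (a + 1)) (powPolarizationClass A h (a + 1)) :
          Set (Module.End ℂ (complexBetti (A.powSucc (a + 1)).X 1)))
  | 0, ψ => pullbackOne_prod_mem_adjoin_symmetricPullbackSpan hA0 hh hnd htop ψ
  | a + 1, ψ => by
    obtain ⟨j, q, hjq⟩ := exists_section_powSucc A (a + 1)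
    exact pullbackOne_prod_mem_adjoin_symmetricPullbackSpan_of_retract (dim_powSucc_pos hA0 (a + 1)) hA0
      (powPolarizationClass_mem_hodgeClassSpan hh (a + 1)) hh
      (eq_zero_of_forall_polarizationPairingOne_powPolarizationClass_eq_zero hA0 htop hnd (a + 1)) hnd
      (lefschetzPow_powPolarizationClass_self_ne_zero hA0 htop (a + 1)) htop
      (fun T hT ↦ (Submodule.span_le (p := Subalgebra.toSubmodule (Algebra.adjoin ℂ
          (symmetricPullbackSpan (A.powSucc (a + 1)) (powPolarizationClass A h (a + 1)) :
            Set (Module.End ℂ (complexBetti (A.powSucc (a + 1)).X 1)))))).2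
        (by
          rintro _ ⟨χ, rfl⟩
          exact pullbackOne_powSucc_mem_adjoin_symmetricPullbackSpan hA0 hh hnd htop a χ) hT)
      hjq ψ

/-- **«`B = Mat_m(D)`», all `m ≥ 2`: `B(A^{a+2}) ⊗ ℂ = End⁰(A^{a+2}) ⊗ ℂ`** — the subalgebra of
`End_ℂ H¹(A^{a+2}(ℂ); ℂ)` generated by `S_λ(A^{a+2}) ⊗ ℂ` is, as a subspace, the `ℂ`-span of the pull-backs `ψ^*`,
`ψ ∈ End(A^{a+2})`. [cite: MoonenZarhin1998WeilClasses, §1 (chunk p0002 L68–L80; chunk p0003 «B = Mat_m(D)»)]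
[cite: Milne1999LefschetzClasses, §1 Remark 1.2 (p. 643)] -/
theorem adjoin_symmetricPullbackSpan_powSucc_eq_span (hA0 : 0 < A.dim) (hh : h ∈ hodgeClassSpan A.dim A.X 1)
    (hnd : ∀ x : complexBetti A.X 1, (∀ y, polarizationPairingOne A.X h (A.dim - 1) x y = 0) → x = 0)
    (htop : lefschetzPow h (A.dim - 1) 2 h ≠ 0) (a : ℕ) :
    Subalgebra.toSubmodule (Algebra.adjoin ℂ
        (symmetricPullbackSpan (A.powSucc (a + 1)) (powPolarizationClass A h (a + 1)) :
          Set (Module.End ℂ (complexBetti (A.powSucc (a + 1)).X 1)))) =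
      Submodule.span ℂ (Set.range fun ψ : A.powSucc (a + 1) ⟶ A.powSucc (a + 1) ↦
        pullbackOne (A.powSucc (a + 1)) ψ) := by
  refine le_antisymm ?_ (Submodule.span_le.2 ?_)
  · have hle : Algebra.adjoin ℂ
          (symmetricPullbackSpan (A.powSucc (a + 1)) (powPolarizationClass A h (a + 1)) :
            Set (Module.End ℂ (complexBetti (A.powSucc (a + 1)).X 1))) ≤
        Subalgebra.centralizer ℂ (centralizerAlgebra (A.powSucc (a + 1)) :
          Set (Module.End ℂ (complexBetti (A.powSucc (a + 1)).X 1))) :=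
      Algebra.adjoin_le fun T hT ↦ mem_bicommutant_iff_mem_span.2 (symmetricPullbackSpan_le_span hT)
    intro T hT
    exact mem_bicommutant_iff_mem_span.1 (hle ((Subalgebra.mem_toSubmodule _).1 hT))
  · rintro _ ⟨ψ, rfl⟩
    exact pullbackOne_powSucc_mem_adjoin_symmetricPullbackSpan hA0 hh hnd htop a ψ

/-- **Moonen–Zarhin 1998, §1: «`G_div(X)` is the centralizer of `Δ = D` in `SP(V_Y, φ_Y)` …», all `m ≥ 2`, on the
carrier: `G_div(A^{a+2})(H)(ℂ) = S(A^{a+2})(H)(ℂ)`** for `H = Σᵢ prᵢ^* h` — Moonen–Zarhin's group (automorphisms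
of `H¹(A^{a+2}(ℂ); ℂ)` commuting with `S_λ ⊗ ℂ` and preserving `Q_H`) is Milne's `S(A^{a+2})(H)(ℂ)` (commuting with
EVERY `ψ^*`). [cite: MoonenZarhin1998WeilClasses, §1 (chunk p0002 L68–L80)] [cite: Milne1999LefschetzClasses, §1 p. 644] -/
theorem divisorLefschetzGroup_powSucc_eq_unitaryCentralizerGroup (hA0 : 0 < A.dim)
    (hh : h ∈ hodgeClassSpan A.dim A.X 1)
    (hnd : ∀ x : complexBetti A.X 1, (∀ y, polarizationPairingOne A.X h (A.dim - 1) x y = 0) → x = 0)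
    (htop : lefschetzPow h (A.dim - 1) 2 h ≠ 0) (a : ℕ) :
    divisorLefschetzGroup (A.powSucc (a + 1)) (powPolarizationClass A h (a + 1)) =
      unitaryCentralizerGroup (A.powSucc (a + 1)) (powPolarizationClass A h (a + 1)) :=
  divisorLefschetzGroup_eq_unitaryCentralizerGroup_of_forall_mem_adjoin
    (pullbackOne_powSucc_mem_adjoin_symmetricPullbackSpan hA0 hh hnd htop a)

/-- **«embedded diagonally», one direction**: for `u ∈ S(A)(h)(ℂ)` the diagonal automorphism `u^{⊕(a+2)}` of
`H¹(A^{a+2}(ℂ); ℂ)` lies in `G_div(A^{a+2})(H)(ℂ)` (the lane's `Milne1999.diagPow_mem_unitaryCentralizerGroup`).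
[cite: MoonenZarhin1998WeilClasses, §1 (chunk p0002 L68–L80 «embedded diagonally»)] [cite: Milne1999LefschetzClasses, §1 p. 643] -/
theorem diagPow_mem_divisorLefschetzGroup_powSucc (hA0 : 0 < A.dim) (hh : h ∈ hodgeClassSpan A.dim A.X 1)
    (hnd : ∀ x : complexBetti A.X 1, (∀ y, polarizationPairingOne A.X h (A.dim - 1) x y = 0) → x = 0)
    (htop : lefschetzPow h (A.dim - 1) 2 h ≠ 0) (a : ℕ) {u : complexBetti A.X 1 ≃ₗ[ℂ] complexBetti A.X 1}
    (hu : u ∈ unitaryCentralizerGroup A h) :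
    diagPow A u (a + 1) ∈ divisorLefschetzGroup (A.powSucc (a + 1)) (powPolarizationClass A h (a + 1)) := by
  rw [divisorLefschetzGroup_powSucc_eq_unitaryCentralizerGroup hA0 hh hnd htop a]
  exact diagPow_mem_unitaryCentralizerGroup hA0 hu (a + 1)

/-- **«`G_div(X)` is the centralizer of `D` in `SP(V_Y, φ_Y)`, embedded diagonally into `SP(V, φ)`», all `m ≥ 2`,
on the carrier: every element of `G_div(A^{a+2})(H)(ℂ)` is a diagonal `u^{⊕(a+2)}` with `u ∈ S(A)(h)(ℂ)`** (Milne §1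
p. 643 «the diagonal action of `C(A)` on `rV(A)` identifies `C(A)` with `C(A^r)`», the lane's
`exists_eq_diagPow_of_mem_centralizerGroup`; the last block of `u^{⊕(a+2)}` is `u`, which therefore preserves
`Q_h`, `polarizationPairingOne_prodRestrictSnd_eq_smul`). With `diagPow_mem_divisorLefschetzGroup_powSucc` and the
injectivity of `u ↦ u^{⊕(a+2)}` (`Milne1999.diagPow_injective`): `G_div(A^{a+2})(H)(ℂ) ≅ S(A)(h)(ℂ)`.
[cite: MoonenZarhin1998WeilClasses, §1 (chunk p0002 L68–L80)] [cite: Milne1999LefschetzClasses, §1 pp. 643–644] -/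
theorem exists_eq_diagPow_of_mem_divisorLefschetzGroup_powSucc (hA0 : 0 < A.dim)
    (hh : h ∈ hodgeClassSpan A.dim A.X 1)
    (hnd : ∀ x : complexBetti A.X 1, (∀ y, polarizationPairingOne A.X h (A.dim - 1) x y = 0) → x = 0)
    (htop : lefschetzPow h (A.dim - 1) 2 h ≠ 0) (a : ℕ)
    {U : complexBetti (A.powSucc (a + 1)).X 1 ≃ₗ[ℂ] complexBetti (A.powSucc (a + 1)).X 1}
    (hU : U ∈ divisorLefschetzGroup (A.powSucc (a + 1)) (powPolarizationClass A h (a + 1))) :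
    ∃ u ∈ unitaryCentralizerGroup A h, diagPow A u (a + 1) = U := by
  rw [divisorLefschetzGroup_powSucc_eq_unitaryCentralizerGroup hA0 hh hnd htop a] at hU
  obtain ⟨u, huC, huU⟩ := exists_eq_diagPow_of_mem_centralizerGroup (a + 1) U hU.1
  refine ⟨u, ⟨huC, fun y y' ↦ ?_⟩, huU⟩
  have hUC : U ∈ centralizerGroup ((A.powSucc a).prod A) := hU.1
  have key := polarizationPairingOne_prodRestrictSnd_eq_smul (powPolarizationClass A h a) h
    (lefschetzPow_powPolarizationClass_self_ne_zero hA0 htop a) hUC 1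
    (fun x x' ↦ by rw [one_smul]; exact hU.2 x x') y y'
  rw [one_smul, ← huU] at key
  change polarizationPairingOne A.X h (A.dim - 1) (prodRestrictSnd (diagPow A u (a + 1)).toLinearMap y)
    (prodRestrictSnd (diagPow A u (a + 1)).toLinearMap y') = _ at key
  rwa [prodRestrictSnd_diagPow_succ, prodRestrictSnd_diagPow_succ] at key

/-- **Moonen–Zarhin 1998, §1, all `m ≥ 2`, in one line: `G_div(A^{a+2})(H)(ℂ) = {u^{⊕(a+2)} : u ∈ S(A)(h)(ℂ)}`** —
«`G_div(X)` is the centralizer of `Δ = D = End⁰(Y)` in `SP(V_Y, φ_Y)`, embedded diagonally into `SP(V, φ)`»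
(`X = Y^m`, `m ≥ 2`), on the carrier, for every complex abelian variety `A` in the rôle of `Y`.
[cite: MoonenZarhin1998WeilClasses, §1 (chunk p0002 L68–L80)] [cite: Milne1999LefschetzClasses, §1 pp. 643–644] -/
theorem mem_divisorLefschetzGroup_powSucc_iff_exists_diagPow (hA0 : 0 < A.dim)
    (hh : h ∈ hodgeClassSpan A.dim A.X 1)
    (hnd : ∀ x : complexBetti A.X 1, (∀ y, polarizationPairingOne A.X h (A.dim - 1) x y = 0) → x = 0)
    (htop : lefschetzPow h (A.dim - 1) 2 h ≠ 0) (a : ℕ)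
    {U : complexBetti (A.powSucc (a + 1)).X 1 ≃ₗ[ℂ] complexBetti (A.powSucc (a + 1)).X 1} :
    U ∈ divisorLefschetzGroup (A.powSucc (a + 1)) (powPolarizationClass A h (a + 1)) ↔
      ∃ u ∈ unitaryCentralizerGroup A h, diagPow A u (a + 1) = U :=
  ⟨exists_eq_diagPow_of_mem_divisorLefschetzGroup_powSucc hA0 hh hnd htop a, by
    rintro ⟨u, hu, rfl⟩
    exact diagPow_mem_divisorLefschetzGroup_powSucc hA0 hh hnd htop a hu⟩

end Powers

end Literature.AlgebraicGeometry.HodgeTheory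

end
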